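import Mathlib
import Summits.KontsevichZagierPeriods.Zeta5Search.BrickLaurentValuation

/-!
# ScaledSeries — `(w,e)`-integrality of power series with INTEGER slope and budget (negative slopes, offsets,
rescaling), extending `BrickLaurentValuation.IsScaledInt` (cell zeta5-irr)

HONEST FRAMING: systematic search; no irrationality claim unless certified. INSTRUMENT lemma of the ζ(5)
census cell zeta5-irr (HOME `run/shared/lean/pub/zeta5-irr/`; asked for by zi-p2 g12, HOME INBOX
2026-08-27T03:20:27Z (ii): «let the (w,e)-integrality predicate take w NEGATIVE … allow the shifted form
v(coeff_d) ≥ c₀ − w·d with an OFFSET c₀ … closure under products and under (1 − X/y)^{±m}», for THEOREM 7's LEMMA 2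
`F_K(pT) = λ_K·F̃_{K′}(T)·E_K(T)·U_K(T)` with `U_K ∈ 1 + pTℤ_(p)⟦T⟧` (PLAN-T7 (★): `v_p([T^g]U_j) ≥ g`, slope `−1`)).
Nothing here is about ζ(5); no irrationality content; filing moves no rung. Filed by the engine seat zi-eng (g8).
(The tree file `BrickLaurentValuation` is append-only; its `ℕ`-slope predicate stays and is bridged here.)

## The statement

**`IsSlopeInt p w e f :⇔ v_p([T^k]f) ≥ −(w·k + e)` for all `k`, with `w, e ∈ ℤ`.** An OFFSET `c₀` («`v ≥ c₀ − w·k`»)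
is the budget `e = −c₀`; slope `−1`, budget `0` is `[T^k]f ∈ p^kℤ_(p)`. Calculus: `isSlopeInt_iff_isScaledInt`
(agrees with `IsScaledInt` on `ℕ`), monotone in `e` and `w`, `1`, products (`_mul`, `_prod`, `_pow`), constants
(`_C_mul`: budget shifts by `−v_p(c)`; `_C`), **rescaling** (`_rescale`: `f(p^v·T)` has slope `w − v`), the linear
factor `1 + T/x` (`_lin`: `(w, c)` if `v_p(x) ≤ w + c`, `c ≥ 0`) and its inverse `geom x⁻¹ = (1 + T/x)^{−1}` (`_geom`:
`(w, 0)` if `v_p(x) ≤ w`), hence `(1 + T/x)^{±m}` by `_pow`; and the coefficient extraction `padicValuation_coeff_le`.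
-/

namespace Summit.KontsevichZagierPeriods.Zeta5Search.ScaledSeries

open Finset Nat Polynomial WithZero
open Summit.KontsevichZagierPeriods.Zeta5Search.BrickLaurentValuation (IsScaledInt lin geom)

noncomputable section

variable {p : ℕ} [Fact p.Prime]

/-- `IsSlopeInt p w e f`: `v_p([T^k]f) ≥ −(w·k + e)` for every `k`, slope `w ∈ ℤ`, budget `e ∈ ℤ`. -/
def IsSlopeInt (p : ℕ) [Fact p.Prime] (w e : ℤ) (f : PowerSeries ℚ) : Prop :=
  ∀ k : ℕ, Rat.padicValuation p (PowerSeries.coeff k f) ≤ exp (w * k + e)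

/-- On natural slopes and budgets `IsSlopeInt` is `BrickLaurentValuation.IsScaledInt`. -/
theorem isSlopeInt_iff_isScaledInt (w e : ℕ) (f : PowerSeries ℚ) :
    IsSlopeInt p w e f ↔ IsScaledInt p w e f := by
  refine forall_congr' fun k => ?_
  rw [show ((w : ℤ) * k + e) = ((w * k + e : ℕ) : ℤ) by push_cast; ring]

/-- The coefficient bound, extracted. -/
theorem padicValuation_coeff_le {w e : ℤ} {f : PowerSeries ℚ} (hf : IsSlopeInt p w e f) (k : ℕ) :
    Rat.padicValuation p (PowerSeries.coeff k f) ≤ exp (w * k + e) := hf k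

/-- Monotonicity in the budget. -/
theorem isSlopeInt_mono {w e e' : ℤ} (h : e ≤ e') {f : PowerSeries ℚ} (hf : IsSlopeInt p w e f) :
    IsSlopeInt p w e' f :=
  fun k => (hf k).trans (exp_le_exp.2 (by gcongr))

/-- Monotonicity in the slope. -/
theorem isSlopeInt_mono_left {w w' e : ℤ} (h : w ≤ w') {f : PowerSeries ℚ} (hf : IsSlopeInt p w e f) :
    IsSlopeInt p w' e f :=
  fun k => (hf k).trans (exp_le_exp.2 (by gcongr))

/-- `1` is `(w, 0)`-integral for every slope. -/
theorem isSlopeInt_one (w : ℤ) : IsSlopeInt p w 0 (1 : PowerSeries ℚ) := by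
  intro k
  rw [PowerSeries.coeff_one]
  split_ifs with h
  · subst h; rw [map_one, Nat.cast_zero, mul_zero, zero_add, exp_zero]
  · rw [map_zero]; exact _root_.zero_le

/-- A constant `c` is `(w, e)`-integral when `v_p(c) ≥ −e`. -/
theorem isSlopeInt_C (w : ℤ) {e : ℤ} {c : ℚ} (hc : Rat.padicValuation p c ≤ exp e) :
    IsSlopeInt p w e (PowerSeries.C c) := by
  intro k
  rw [PowerSeries.coeff_C]
  split_ifs with h
  · subst h; rwa [Nat.cast_zero, mul_zero, zero_add]
  · rw [map_zero]; exact _root_.zero_le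

/-- **Multiplicativity**: budgets add. -/
theorem isSlopeInt_mul {w e₁ e₂ : ℤ} {f g : PowerSeries ℚ} (hf : IsSlopeInt p w e₁ f) (hg : IsSlopeInt p w e₂ g) :
    IsSlopeInt p w (e₁ + e₂) (f * g) := by
  intro k
  rw [PowerSeries.coeff_mul]
  refine Valuation.map_sum_le _ fun x hx => ?_
  rw [map_mul]
  have hk := mem_antidiagonal.1 hx
  calc Rat.padicValuation p (PowerSeries.coeff x.1 f) * Rat.padicValuation p (PowerSeries.coeff x.2 g)
      ≤ exp (w * x.1 + e₁) * exp (w * x.2 + e₂) := mul_le_mul' (hf x.1) (hg x.2)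
    _ = exp (w * k + (e₁ + e₂)) := by rw [← exp_add, ← hk]; congr 1; push_cast; ring

/-- A constant factor shifts the budget by `−v_p(c)` (this is how an OFFSET `c₀ = v_p(c)` enters). -/
theorem isSlopeInt_C_mul {w e₀ e : ℤ} {c : ℚ} (hc : Rat.padicValuation p c ≤ exp e₀) {f : PowerSeries ℚ}
    (hf : IsSlopeInt p w e f) : IsSlopeInt p w (e₀ + e) (PowerSeries.C c * f) := by
  simpa using isSlopeInt_mul (isSlopeInt_C w hc) hf

/-- Products over a finset. -/
theorem isSlopeInt_prod {ι : Type*} {w : ℤ} {e : ι → ℤ} {f : ι → PowerSeries ℚ} (s : Finset ι)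
    (h : ∀ i ∈ s, IsSlopeInt p w (e i) (f i)) : IsSlopeInt p w (∑ i ∈ s, e i) (∏ i ∈ s, f i) := by
  classical
  induction s using Finset.induction_on with
  | empty => simpa using isSlopeInt_one (p := p) w
  | insert a s ha ih =>
    rw [Finset.prod_insert ha, Finset.sum_insert ha]
    exact isSlopeInt_mul (h a (mem_insert_self a s)) (ih fun i hi => h i (mem_insert_of_mem hi))

/-- Powers. -/
theorem isSlopeInt_pow {w e : ℤ} {f : PowerSeries ℚ} (hf : IsSlopeInt p w e f) (m : ℕ) :
    IsSlopeInt p w (m * e) (f ^ m) := by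
  induction m with
  | zero => simpa using isSlopeInt_one (p := p) w
  | succ m ih => rw [pow_succ, Nat.cast_succ, add_mul, one_mul]; exact isSlopeInt_mul ih hf

/-- **Rescaling lowers the slope**: if `f` is `(w, e)`-integral then `f(p^v·T) = rescale (p^v) f` is
`(w − v, e)`-integral. (PLAN-T7 (★): `U_j(T) = V(pT)`, `V ∈ ℤ_(p)⟦T⟧` ⇒ `v_p([T^g]U_j) ≥ g`.) -/
theorem isSlopeInt_rescale {w e : ℤ} {f : PowerSeries ℚ} (hf : IsSlopeInt p w e f) (v : ℕ) :
    IsSlopeInt p (w - v) e (PowerSeries.rescale ((p : ℚ) ^ v) f) := by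
  intro k
  rw [PowerSeries.coeff_rescale, map_mul]
  calc Rat.padicValuation p (((p : ℚ) ^ v) ^ k) * Rat.padicValuation p (PowerSeries.coeff k f)
      ≤ Rat.padicValuation p (((p : ℚ) ^ v) ^ k) * exp (w * k + e) := mul_le_mul' le_rfl (hf k)
    _ = exp ((w - v) * k + e) := by
        rw [map_pow, map_pow, Rat.padicValuation_self, ← pow_mul, ← exp_nsmul, ← exp_add, nsmul_eq_mul]
        congr 1; push_cast; ring

/-- The converse direction of rescaling: `rescale (p^v) f` `(w, e)`-integral ⇒ `f` `(w + v, e)`-integral. -/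
theorem isSlopeInt_of_rescale {w e : ℤ} {f : PowerSeries ℚ} (v : ℕ)
    (hf : IsSlopeInt p w e (PowerSeries.rescale ((p : ℚ) ^ v) f)) : IsSlopeInt p (w + v) e f := by
  intro k
  have h := hf k
  rw [PowerSeries.coeff_rescale, map_mul, map_pow, map_pow, Rat.padicValuation_self, ← pow_mul, ← exp_nsmul,
    nsmul_eq_mul] at h
  have hne : exp ((v * k : ℕ) * (-1 : ℤ)) ≠ 0 := exp_ne_zero
  calc Rat.padicValuation p (PowerSeries.coeff k f)
      = (exp ((v * k : ℕ) * (-1 : ℤ)))⁻¹ * (exp ((v * k : ℕ) * (-1 : ℤ)) *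
          Rat.padicValuation p (PowerSeries.coeff k f)) := by rw [← mul_assoc, inv_mul_cancel₀ hne, one_mul]
    _ ≤ (exp ((v * k : ℕ) * (-1 : ℤ)))⁻¹ * exp (w * k + e) := mul_le_mul' le_rfl h
    _ = exp ((w + v) * k + e) := by rw [← exp_neg, ← exp_add]; congr 1; push_cast; ring

/-- `1 + T/x` is `(w, c)`-integral when `v_p(1/x) ≥ −(w + c)` and `c ≥ 0`. -/
theorem isSlopeInt_lin {w c : ℤ} (hc : 0 ≤ c) {x : ℚ} (hx : Rat.padicValuation p x⁻¹ ≤ exp (w + c)) :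
    IsSlopeInt p w c (lin x) := by
  intro k
  rw [lin, map_add, PowerSeries.coeff_one, ← pow_one PowerSeries.X, PowerSeries.coeff_C_mul_X_pow]
  rcases k with _ | _ | k
  · rw [if_pos rfl, if_neg (by omega), add_zero, map_one, Nat.cast_zero, mul_zero, zero_add, ← exp_zero, exp_le_exp]
    exact hc
  · rw [if_neg (by omega), if_pos rfl, zero_add, Nat.cast_one, mul_one]; exact hx
  · rw [if_neg (by omega), if_neg (by omega), add_zero, map_zero]; exact _root_.zero_le

/-- `geom y = (1 + yT)^{−1}` is `(w, 0)`-integral when `v_p(y) ≥ −w`; with `y = x⁻¹` this is `(1 + T/x)^{−1}`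
(`BrickLaurentValuation.lin_inv`). -/
theorem isSlopeInt_geom {w : ℤ} {y : ℚ} (hy : Rat.padicValuation p y ≤ exp w) : IsSlopeInt p w 0 (geom y) := by
  intro k
  rw [geom, PowerSeries.coeff_mk, map_pow, Valuation.map_neg, add_zero, mul_comm, ← nsmul_eq_mul, exp_nsmul]
  exact pow_le_pow_left' hy k

/-- `(1 + T/x)^{−m} = (geom x⁻¹)^m` is `(w, 0)`-integral when `v_p(x⁻¹) ≥ −w` (the `(1 − X/y)^{−m}` of zi-p2's request,
`x = −y`). -/
theorem isSlopeInt_lin_inv_pow {w : ℤ} {x : ℚ} (hx : Rat.padicValuation p x⁻¹ ≤ exp w) (m : ℕ) :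
    IsSlopeInt p w 0 ((lin x)⁻¹ ^ m) := by
  rw [BrickLaurentValuation.lin_inv]
  simpa using isSlopeInt_pow (isSlopeInt_geom hx) m

/-- Sanity: the constant series `p` has slope `0`, budget `−1` (`v_p(p) = 1 ≥ 1`). -/
example : IsSlopeInt p 0 (-1) (PowerSeries.C (p : ℚ)) :=
  isSlopeInt_C 0 (by rw [Rat.padicValuation_self])

end

end Summit.KontsevichZagierPeriods.Zeta5Search.ScaledSeries
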